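import Literature.Computability.AlgebraicComplexity.PolynomialKoszulYoungFlatteningBorderRank
import Literature.Computability.AlgebraicComplexity.LinearPowersSpan
import Literature.Computability.AlgebraicComplexity.StandardFamilies
import Mathlib.FieldTheory.IsAlgClosed.Basic
import Mathlib.Analysis.Complex.Polynomial.Basic
import HarnessLib

/-!
# Symmetric border rank of the determinant from Koszul–Young flattening ranks (the schema of
# Farnsworth 2016, Thm. 1.6, as a Lean theorem with the rank as its only input)

Topic `Literature/Computability/AlgebraicComplexity`; companion of
`PolynomialKoszulYoungFlatteningBorderRank.lean` (Landsberg 2017, Prop. 8.2.1.1 for the Koszul–Young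
flattening: `R̲_S(f) ≤ r ⟹ rank(f^{∧p}_{k,d-k}) ≤ r · binom(n-1, p)`) and of `LinearPowersSpan.lean` (powers of
linear forms span the forms of each degree in characteristic zero).

**What is here.**

* `exists_mem_waringSums_of_isHomogeneous`: over an ALGEBRAICALLY CLOSED field of characteristic zero every form of
  degree `d ≥ 1` is a sum of `d`-th powers of linear forms (the tree's span theorem
  `mem_span_linearPowers_of_isHomogeneous` plus `d`-th roots of the coefficients), so its symmetric (border) rank
  is defined — Landsberg §6.2.2 defines `R_S(P)`, `R̲_S(P)` for every `P ∈ S^dV` over `ℂ`;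
  `exists_isBorderWaringRankLE_of_isHomogeneous`, and Prop. 8.2.1.1 WITHOUT the side hypothesis
  "`f` has a symmetric border rank": `lt_borderPolyWaringRank_of_mul_lt_of_isHomogeneous`.
* `detFin F m`, `perFin F m`: the generic determinant / permanent `det_m`, `per_m` as forms in the `m · m` NUMBERED
  variables `Fin (m * m)` (renaming `X_{ij} ↦ X_{finProdFinEquiv (i,j)}` of the tree's `detPoly (Fin m) F`,
  `perPoly (Fin m) F`), so that `borderPolyWaringRank` / `kyRankFin` (stated on `Fin n`) apply;
  `kyRank_detPoly_eq_kyRankFin_detFin`: the tree's numbering-free `kyRank F p k (detPoly (Fin m) F)` is the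
  `kyRankFin` of `detFin F m` (via `kyRankFin_rename_equiv`, `kyRank_eq_kyRankFin_rename_equiv`).
* **The schema** `lt_borderPolyWaringRank_detFin_of_mul_lt` (and `…_perFin_…`): for `k < m`,
  `r · binom(m·m - 1, p) < rank KY_{p,k}(det_m) ⟹ r < R̲_S(det_m)`. This is exactly the inference of
  Farnsworth 2016 (Prop. 2.4 = Landsberg–Ottaviani Prop. 4.1, applied in Thm. 1.6: `rank = 560`, `r₀ = 15` at
  `(p,k) = (14,1)` give `R̲_S(det₄) ≥ 38`); the RANK itself is an input (hypothesis), not computed here — instances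
  with explicit rank hypotheses live on the Summits side (`Summits/PneNP/GCT/Certificates/`).

Everything is a definition with a body or a theorem; no named facts.

## References

* [LandsbergGCT2017] J. M. Landsberg, *Geometry and Complexity Theory*, CUP 2017, §6.2.2 (symmetric rank and
  symmetric border rank of `P ∈ S^dV`, held PDF p. 158), §8.2.1 Prop. 8.2.1.1 (held PDF p. 221).
* [Farnsworth2016] C. Farnsworth, *Koszul–Young flattenings and symmetric border rank of the determinant*,
  J. Algebra 447 (2016) 664–676, Prop. 2.4, Thm. 1.6, Thm. 1.8.
* [GargMakamOliveiraWigderson2019] Def. 1.1 / 1.4 (powers of linear forms as a spanning set) — via the tree's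
  `LinearPowersSpan.lean`.
-/

noncomputable section

open MvPolynomial

namespace Literature.Computability.AlgebraicComplexity

/-! ## Every form over an algebraically closed field of characteristic zero has a Waring decomposition -/

section Waring

variable {F : Type*} [Field F] {n : ℕ}

/-- `ℓ_{c•a} = c · ℓ_a`. [folklore] -/
private theorem linearForm_smul' (c : F) (a : Fin n → F) : linearForm (c • a) = C c * linearForm a := by
  unfold linearForm
  rw [Finset.mul_sum]
  refine Finset.sum_congr rfl fun i _ => ?_
  rw [Pi.smul_apply, smul_eq_mul, C_mul, mul_assoc]

/-- **Every form of degree `d ≥ 1` over an algebraically closed field of characteristic zero is a sum of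
`d`-th powers of linear forms** (`P = ℓ_1^d + ⋯ + ℓ_r^d` for some `r`: the symmetric rank `R_S(P)` of
Landsberg §6.2.2 is defined for every `P`). Proof: `P` is a linear combination of powers of linear forms
(`mem_span_linearPowers_of_isHomogeneous`, characteristic zero) and each coefficient is a `d`-th power.
[cite: LandsbergGCT2017, §6.2.2 (held PDF p. 158)] -/
theorem exists_mem_waringSums_of_isHomogeneous [IsAlgClosed F] [CharZero F] {d : ℕ} (hd : 0 < d)
    {f : MvPolynomial (Fin n) F} (hf : f.IsHomogeneous d) : ∃ r, f ∈ waringSums F n d r := by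
  obtain ⟨r, c, g, hsum⟩ := Submodule.mem_span_set'.1 (mem_span_linearPowers_of_isHomogeneous hf)
  have hg : ∀ i, ∃ a : Fin n → F, linearForm a ^ d = (g i : MvPolynomial (Fin n) F) := fun i => (g i).2
  choose a ha using hg
  have hc : ∀ i, ∃ μ : F, μ ^ d = c i := fun i => IsAlgClosed.exists_pow_nat_eq (c i) hd
  choose μ hμ using hc
  refine ⟨r, fun i => μ i • a i, ?_⟩
  rw [← hsum]
  refine Finset.sum_congr rfl fun i _ => ?_
  rw [linearForm_smul', mul_pow, ← C_pow, hμ, ha, smul_eq_C_mul]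

/-- Hence every form of degree `d ≥ 1` over an algebraically closed field of characteristic zero HAS a symmetric
border rank: `R̲_S(f) ≤ r` for some `r`. [cite: LandsbergGCT2017, §6.2.2 (held PDF p. 158)] -/
theorem exists_isBorderWaringRankLE_of_isHomogeneous [IsAlgClosed F] [CharZero F] {d : ℕ} (hd : 0 < d)
    {f : MvPolynomial (Fin n) F} (hf : f.IsHomogeneous d) : ∃ r, IsBorderWaringRankLE d r f := by
  obtain ⟨r, hr⟩ := exists_mem_waringSums_of_isHomogeneous hd hf
  exact ⟨r, isBorderWaringRankLE_of_mem_waringSums hr⟩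

/-- `R̲_S(f) ≤ R_S(f)` for every form of degree `d ≥ 1` (algebraically closed field, characteristic zero).
[cite: LandsbergGCT2017, §6.2.2 (held PDF p. 158)] -/
theorem borderPolyWaringRank_le_polyWaringRank_of_isHomogeneous [IsAlgClosed F] [CharZero F] {d : ℕ}
    (hd : 0 < d) {f : MvPolynomial (Fin n) F} (hf : f.IsHomogeneous d) :
    borderPolyWaringRank d f ≤ polyWaringRank d f := by
  obtain ⟨r, a, ha⟩ := exists_mem_waringSums_of_isHomogeneous hd hf
  exact borderPolyWaringRank_le_polyWaringRank ⟨r, a, ha⟩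

/-- **Landsberg's Prop. 8.2.1.1 for forms over `ℂ`-like fields, no side hypothesis**:
`rank(f^{∧p}_{k,d-k}) ≤ R̲_S(f) · binom(n-1, p)` for every form `f` of degree `d > k`.
[cite: LandsbergGCT2017, Prop. 8.2.1.1 (held PDF p. 221)] -/
theorem kyRankFin_le_borderPolyWaringRank_mul_of_isHomogeneous [IsAlgClosed F] [CharZero F] {d k : ℕ}
    (p : ℕ) (hk : k < d) {f : MvPolynomial (Fin n) F} (hf : f.IsHomogeneous d) :
    kyRankFin F p k f ≤ borderPolyWaringRank d f * (n - 1).choose p :=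
  kyRankFin_le_borderPolyWaringRank_mul p hk (exists_isBorderWaringRankLE_of_isHomogeneous (by omega) hf)

/-- **`R̲_S(f) ≥ r/r₀` in integers, no side hypothesis**: for a form `f` of degree `d > k` over an algebraically
closed field of characteristic zero, `r · binom(n-1, p) < rank(f^{∧p}_{k,d-k}) ⟹ r < R̲_S(f)`.
[cite: LandsbergGCT2017, Prop. 8.2.1.1 (held PDF p. 221)] [cite: Farnsworth2016, Prop. 2.4] -/
theorem lt_borderPolyWaringRank_of_mul_lt_of_isHomogeneous [IsAlgClosed F] [CharZero F] {d r k : ℕ}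
    (p : ℕ) (hk : k < d) {f : MvPolynomial (Fin n) F} (hf : f.IsHomogeneous d)
    (hlt : r * (n - 1).choose p < kyRankFin F p k f) : r < borderPolyWaringRank d f :=
  lt_borderPolyWaringRank_of_mul_lt p hk (exists_isBorderWaringRankLE_of_isHomogeneous (by omega) hf) hlt

end Waring

/-! ## Renumbering variables along a bijection `Fin a ≃ Fin b` / `σ ≃ Fin b` -/

section Rename

variable {K : Type*} [Field K]

/-- `kyRankFin` is invariant under renaming along ANY bijection `Fin a ≃ Fin b` (then `a = b` and this is the
tree's `kyRankFin_rename`). [cite: LandsbergGCT2017, §8.2.1 (the map (8.2.1) is a `GL(V)`-module map)] -/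
theorem kyRankFin_rename_equiv {a b : ℕ} (e : Fin a ≃ Fin b) (p k : ℕ) (f : MvPolynomial (Fin a) K) :
    kyRankFin K p k (rename e f) = kyRankFin K p k f := by
  have hab : a = b := by simpa using Fintype.card_congr e
  subst hab
  exact kyRankFin_rename e p k f

/-- `kyRank K p k f = kyRankFin K p k (rename e f)` for ANY numbering `e : σ ≃ Fin b` of the variables
(the tree's `kyRank_eq_kyRankFin_rename` is the case `b = card σ`).
[cite: LandsbergGCT2017, §8.2.1 (the map (8.2.1) is a `GL(V)`-module map)] -/
theorem kyRank_eq_kyRankFin_rename_equiv {σ : Type*} [Fintype σ] [DecidableEq σ] {b : ℕ} (e : σ ≃ Fin b)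
    (p k : ℕ) (f : MvPolynomial σ K) :
    kyRank K p k f = kyRankFin K p k (rename e f) := by
  rw [kyRank_def]
  have hfun : ((((Fintype.equivFin σ).symm.trans e) : Fin (Fintype.card σ) → Fin b) ∘
      (Fintype.equivFin σ : σ → Fin (Fintype.card σ))) = (e : σ → Fin b) := by
    funext x
    simp
  have : rename e f = rename ((Fintype.equivFin σ).symm.trans e) (rename (Fintype.equivFin σ) f) := by
    rw [rename_rename, hfun]
  rw [this, kyRankFin_rename_equiv]

end Rename

/-! ## The determinant and the permanent as forms in `m · m` numbered variables -/

section DetPer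

variable (F : Type*) [Field F]

/-- `det_m` as a form of degree `m` in the `m · m` numbered variables `Fin (m * m)`: the tree's generic determinant
`detPoly (Fin m) F` (variables `X_{ij}`, `(i,j) : Fin m × Fin m`) with `X_{ij}` renamed to `X_{finProdFinEquiv (i,j)}`.
[cite: Farnsworth2016, §1 (det_n ∈ S^n ℂ^{n²})] -/
def detFin (m : ℕ) : MvPolynomial (Fin (m * m)) F :=
  rename finProdFinEquiv (detPoly (Fin m) F)

/-- `per_m` as a form of degree `m` in the `m · m` numbered variables `Fin (m * m)` (same renaming of the tree's
`perPoly (Fin m) F`). [cite: Farnsworth2016, §1 (perm_n ∈ S^n ℂ^{n²})] -/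
def perFin (m : ℕ) : MvPolynomial (Fin (m * m)) F :=
  rename finProdFinEquiv (perPoly (Fin m) F)

variable {F}

/-- `det_m` is a form of degree `m`. [cite: Farnsworth2016, §1] -/
theorem detFin_isHomogeneous (m : ℕ) : (detFin F m).IsHomogeneous m := by
  have h : (detPoly (Fin m) F).IsHomogeneous m := by
    simpa only [Fintype.card_fin] using (detPoly_isHomogeneous : (detPoly (Fin m) F).IsHomogeneous _)
  exact h.rename_isHomogeneous

/-- `per_m` is a form of degree `m`. [cite: Farnsworth2016, §1] -/
theorem perFin_isHomogeneous (m : ℕ) : (perFin F m).IsHomogeneous m := by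
  have h : (perPoly (Fin m) F).IsHomogeneous m := by
    simpa only [Fintype.card_fin] using (perPoly_isHomogeneous : (perPoly (Fin m) F).IsHomogeneous _)
  exact h.rename_isHomogeneous

/-- The numbering-free Koszul–Young rank of `det_m` is the `kyRankFin` of `detFin F m`.
[cite: LandsbergGCT2017, §8.2.1 (the map (8.2.1) is a `GL(V)`-module map)] -/
theorem kyRank_detPoly_eq_kyRankFin_detFin (m p k : ℕ) :
    kyRank F p k (detPoly (Fin m) F) = kyRankFin F p k (detFin F m) :=
  kyRank_eq_kyRankFin_rename_equiv _ p k _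

/-- The numbering-free Koszul–Young rank of `per_m` is the `kyRankFin` of `perFin F m`.
[cite: LandsbergGCT2017, §8.2.1 (the map (8.2.1) is a `GL(V)`-module map)] -/
theorem kyRank_perPoly_eq_kyRankFin_perFin (m p k : ℕ) :
    kyRank F p k (perPoly (Fin m) F) = kyRankFin F p k (perFin F m) :=
  kyRank_eq_kyRankFin_rename_equiv _ p k _

/-- **The schema of Farnsworth's Thm. 1.6 for `det_m`**: over an algebraically closed field of characteristic
zero, for `k < m`, `r · binom(m·m - 1, p) < rank KY_{p,k}(det_m) ⟹ r < R̲_S(det_m)` (Prop. 2.4 with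
`t = rank KY_{p,k}(x^m) = binom(m·m - 1, p)`; the rank is an INPUT — Farnsworth's `560` at `(p,k) = (14,1)`,
`r₀ = 15`, gives `R̲_S(det₄) ≥ 38`). [cite: Farnsworth2016, Prop. 2.4 and Thm. 1.6] [cite: LandsbergGCT2017, Prop. 8.2.1.1 (held PDF p. 221)] -/
theorem lt_borderPolyWaringRank_detFin_of_mul_lt [IsAlgClosed F] [CharZero F] {m p k r : ℕ} (hk : k < m)
    (hlt : r * (m * m - 1).choose p < kyRank F p k (detPoly (Fin m) F)) :
    r < borderPolyWaringRank m (detFin F m) :=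
  lt_borderPolyWaringRank_of_mul_lt_of_isHomogeneous p hk (detFin_isHomogeneous m)
    (by rwa [kyRank_detPoly_eq_kyRankFin_detFin] at hlt)

/-- The same schema for `per_m`: `r · binom(m·m - 1, p) < rank KY_{p,k}(per_m) ⟹ r < R̲_S(per_m)` (`k < m`).
[cite: Farnsworth2016, Prop. 2.4 and Thm. 1.8] [cite: LandsbergGCT2017, Prop. 8.2.1.1 (held PDF p. 221)] -/
theorem lt_borderPolyWaringRank_perFin_of_mul_lt [IsAlgClosed F] [CharZero F] {m p k r : ℕ} (hk : k < m)
    (hlt : r * (m * m - 1).choose p < kyRank F p k (perPoly (Fin m) F)) :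
    r < borderPolyWaringRank m (perFin F m) :=
  lt_borderPolyWaringRank_of_mul_lt_of_isHomogeneous p hk (perFin_isHomogeneous m)
    (by rwa [kyRank_perPoly_eq_kyRankFin_perFin] at hlt)

/-- Upper form of the schema: `rank KY_{p,k}(det_m) ≤ R̲_S(det_m) · binom(m·m - 1, p)` (`k < m`).
[cite: LandsbergGCT2017, Prop. 8.2.1.1 (held PDF p. 221)] [cite: Farnsworth2016, Prop. 2.4] -/
theorem kyRank_detPoly_le_borderPolyWaringRank_mul [IsAlgClosed F] [CharZero F] {m k : ℕ} (p : ℕ)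
    (hk : k < m) :
    kyRank F p k (detPoly (Fin m) F) ≤ borderPolyWaringRank m (detFin F m) * (m * m - 1).choose p := by
  rw [kyRank_detPoly_eq_kyRankFin_detFin]
  exact kyRankFin_le_borderPolyWaringRank_mul_of_isHomogeneous p hk (detFin_isHomogeneous m)

end DetPer

end Literature.Computability.AlgebraicComplexity
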